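import Summits.HodgeConjecture.HodgeConjecture.Theorems.PadicSemiregularLiftHodgeFermatVarietiesFiveQFibre
import Literature.AlgebraicGeometry.HodgeTheory.FermatFourfoldFiveStandardSextuples
import HarnessLib

/-!
# Hodge sextuples of level `5q`, V: the classification — paired or Aoki's `5`-standard element, line `cancel-by-any-claim-lattice`, crux `HodgeFermatVarieties` (stmt-HodgeConjecture-1334)

Sixth file of lead c3's level-`5q` programme. THEOREM (`classification`): for a prime `q ≥ 7`, every Hodge
SEXTUPLE `s` of `ℤ/5q` (the Hodge characters of the Fermat fourfold `X⁴_{5q}`) is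

* a sum of three pairs `{a, -a}` (`𝔇`), or
* Aoki's `5`-standard multiset `σ_{5,a} = {a, a + q, a + 2q, a + 3q, a + 4q} + {-5a}` for a unit `a`
  (written in the spelling of the line's printed supply).

This is the classification `𝔅⁴_{5q} = 𝔇⁴_{5q} ∪ {σ_{5,a}}` that da Silva's Thm 3.3 (arXiv:2101.04739) needs
silently and that the literature consulted by the tree does not contain (see the module docstring of
`Literature/…/FermatFourfoldFiveStandardSextuples`); Aoki 1983 Thm A′ gives `𝔅⁴ₘ = 𝔇⁴ₘ` exactly when
`(m, 30) = 1`. Proof: `structure_units` (II) + the symmetric case (III) + the occupied fibre (IV); here the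
last step — the relation (II) at conductor `q` identifies the two level-`q` entries: with
`Φ = 𝟙_{5b₁} - 𝟙_{b₁} + 𝟙_{ȳ} + 𝟙_{z̄}` orthogonal to the odd characters mod `q`, hence even, one gets
`{ȳ, z̄} = {b₁, -5 b₁}`, i.e. `y` is the missing (non-unit) point of the fibre of `b₁` and `z = -5a`.

The Hodge-conjecture pay-off (every Hodge sextuple of `ℤ/5q` is reachable from the printed supply at its own
level, hence HC for `X⁴_{5q}` modulo the printed facts) is in `…FiveQPayoff`.

References: [Aoki1983] N. Aoki, Math. Ann. 266 (1983) Thm A′ (§7), §5 Prop. 5.1; [Aoki1987] J. Math. Soc.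
Japan 39 (1987) §1; [daSilva2021HodgeFermat] arXiv:2101.04739 Thm 3.3.
-/

set_option linter.dupNamespace false

noncomputable section

open Finset
open Literature.AlgebraicGeometry.HodgeTheory Literature.AlgebraicGeometry.HodgeTheory.FermatCharacter

namespace Summit.HodgeConjecture.HodgeConjecture.Theorems.CancelByAnyClaimLattice.FiveQ

section Level5q

variable {q : ℕ} [Fact q.Prime]

/-! ### §1 (II) identifies the two level-`q` entries -/

/-- **The reductions of the two level-`q` entries are `b₁` and `-5 b₁`** (up to order): the relation (II)
for `s = F + {y, z}` reads `(χ(5) - 1)χ(b₁) + χ(ȳ) + χ(z̄) = 0` for every odd `χ` mod `q`, so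
`Φ = 𝟙_{5b₁} - 𝟙_{b₁} + 𝟙_ȳ + 𝟙_z̄` is even; evaluating at `±b₁` gives `ȳ = b₁` or `z̄ = b₁`.
[cite: Aoki1983, Prop. 2.2] -/
theorem casts_pair_eq (hq : 7 ≤ q) {s : Multiset (ZMod (5 * q))} (hs : IsHodgeMultiset s) {b₁ : (ZMod q)ˣ}
    {y z : ZMod (5 * q)}
    (hsyz : s = (univ.filter fun x : (ZMod (5 * q))ˣ ↦ ZMod.unitsMap (dvd_mul_left q 5) x = b₁).val.map
      (fun x : (ZMod (5 * q))ˣ ↦ (x : ZMod (5 * q))) + {y, z})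
    (hy : ¬ IsUnit y) (hz : ¬ IsUnit z) :
    ZMod.castHom (dvd_mul_left q 5) (ZMod q) y = b₁ ∨ ZMod.castHom (dvd_mul_left q 5) (ZMod q) z = b₁ := by
  classical
  have hpq : (5 : ℕ) ≠ q := five_ne hq
  set yq := ZMod.castHom (dvd_mul_left q 5) (ZMod q) y with hyq
  set zq := ZMod.castHom (dvd_mul_left q 5) (ZMod q) z with hzq
  by_contra hnot
  push Not at hnot
  obtain ⟨hyb, hzb⟩ := hnot
  -- `Φ` is orthogonal to the odd characters mod `q`
  set Φ : ZMod q → ℂ := fun t ↦ (if t = 5 * (b₁ : ZMod q) then 1 else 0) - (if t = (b₁ : ZMod q) then 1 else 0) +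
    (if t = yq then 1 else 0) + (if t = zq then 1 else 0) with hΦ
  have horth : ∀ ψ : DirichletCharacter ℂ q, ψ (-1) = -1 → ∑ t : ZMod q, Φ t * ψ t = 0 := by
    intro ψ hψ
    have hΦsum : ∑ t : ZMod q, Φ t * ψ t = ψ (5 * (b₁ : ZMod q)) - ψ (b₁ : ZMod q) + ψ yq + ψ zq := by
      simp only [hΦ, sub_mul, add_mul, ite_mul, one_mul, zero_mul, Finset.sum_add_distrib, Finset.sum_sub_distrib,
        Finset.sum_ite_eq', Finset.mem_univ, if_true]
    rw [hΦsum]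
    -- (II) for `χ = ψ⁻¹` on `s = F + {y, z}`
    have h2 := stub_twoPrime_level_right 5 q hpq s hs ψ⁻¹ (inv_neg_one_of_odd hψ) (ne_one_of_odd (inv_neg_one_of_odd hψ))
    rw [hsyz, Multiset.map_add, Multiset.sum_add] at h2
    -- the fibre part
    have hF : ((univ.filter fun x : (ZMod (5 * q))ˣ ↦ ZMod.unitsMap (dvd_mul_left q 5) x = b₁).val.map
        (fun x : (ZMod (5 * q))ˣ ↦ (x : ZMod (5 * q)))).map (fun x ↦
          (if IsUnit x then (1 - ψ⁻¹ ((5 : ℕ) : ZMod q)) else ((5 - 1 : ℕ) : ℂ) * ψ⁻¹ ((5 : ℕ) : ZMod q)) *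
            (ψ⁻¹ (ZMod.castHom (dvd_mul_left q 5) (ZMod q) x))⁻¹) =
        ((univ.filter fun x : (ZMod (5 * q))ˣ ↦ ZMod.unitsMap (dvd_mul_left q 5) x = b₁).val.map
          fun _ ↦ (1 - ψ⁻¹ ((5 : ℕ) : ZMod q)) * ψ (b₁ : ZMod q)) := by
      rw [Multiset.map_map]
      refine Multiset.map_congr rfl fun x hx ↦ ?_
      simp only [Finset.mem_val, mem_filter, mem_univ, true_and] at hx
      rw [Function.comp_apply, if_pos (Units.isUnit x), inv_inv_apply, ← coe_unitsMap, hx]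
    have hFsum : (((univ.filter fun x : (ZMod (5 * q))ˣ ↦ ZMod.unitsMap (dvd_mul_left q 5) x = b₁).val.map
          fun _ ↦ (1 - ψ⁻¹ ((5 : ℕ) : ZMod q)) * ψ (b₁ : ZMod q))).sum =
        4 * ((1 - ψ⁻¹ ((5 : ℕ) : ZMod q)) * ψ (b₁ : ZMod q)) := by
      rw [Multiset.map_const', Multiset.sum_replicate, Finset.card_val, card_fibre hpq b₁, nsmul_eq_mul]
      norm_num
    -- the pair part
    have hP : (({y, z} : Multiset (ZMod (5 * q))).map fun x ↦
        (if IsUnit x then (1 - ψ⁻¹ ((5 : ℕ) : ZMod q)) else ((5 - 1 : ℕ) : ℂ) * ψ⁻¹ ((5 : ℕ) : ZMod q)) *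
          (ψ⁻¹ (ZMod.castHom (dvd_mul_left q 5) (ZMod q) x))⁻¹).sum =
        4 * ψ⁻¹ ((5 : ℕ) : ZMod q) * (ψ yq + ψ zq) := by
      simp only [Multiset.insert_eq_cons, Multiset.map_cons, Multiset.map_singleton, Multiset.sum_cons,
        Multiset.sum_singleton, if_neg hy, if_neg hz, inv_inv_apply]
      rw [← hyq, ← hzq]
      push_cast
      ring
    rw [hF, hFsum, hP] at h2
    -- `ψ⁻¹(5) = ψ(5)⁻¹` with `ψ(5) ≠ 0`
    have h5 : IsUnit ((5 : ℕ) : ZMod q) := by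
      rw [ZMod.isUnit_prime_iff_not_dvd Nat.prime_five]
      intro h
      have := (Nat.prime_dvd_prime_iff_eq Nat.prime_five Fact.out).mp h
      omega
    have hψ5 : ψ ((5 : ℕ) : ZMod q) ≠ 0 := (h5.map ψ).ne_zero
    rw [MulChar.inv_apply_eq_inv'] at h2
    have key : (ψ ((5 : ℕ) : ZMod q) - 1) * ψ (b₁ : ZMod q) + ψ yq + ψ zq = 0 := by
      have := congrArg (fun w ↦ ψ ((5 : ℕ) : ZMod q) * w) h2
      simp only [mul_zero] at this
      field_simp at this
      linear_combination this / 4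
    rw [map_mul, show ((5 : ZMod q)) = ((5 : ℕ) : ZMod q) by norm_cast]
    linear_combination key
  -- evenness of `Φ` at `b₁`
  have heven := even_of_orthogonal_odd Φ horth b₁
  -- evaluate both sides
  have h4 : (b₁ : ZMod q) ≠ 5 * (b₁ : ZMod q) := fun h ↦
    small_mul_ne_zero hq b₁ (k := 4) (by norm_num) (by norm_num) (by push_cast; linear_combination -h)
  have h6 : -(b₁ : ZMod q) ≠ 5 * (b₁ : ZMod q) := fun h ↦
    small_mul_ne_zero hq b₁ (k := 6) (by norm_num) (by norm_num) (by push_cast; linear_combination -h)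
  have h2' : -(b₁ : ZMod q) ≠ (b₁ : ZMod q) := fun h ↦
    small_mul_ne_zero hq b₁ (k := 2) (by norm_num) (by norm_num) (by push_cast; linear_combination -h)
  have hL : Φ (b₁ : ZMod q) = -1 := by
    simp only [hΦ, if_neg h4, if_neg (Ne.symm hyb), if_neg (Ne.symm hzb)]
    norm_num
  have hR : Φ (-(b₁ : ZMod q)) = (if -(b₁ : ZMod q) = yq then 1 else 0) + (if -(b₁ : ZMod q) = zq then 1 else 0) := by
    simp only [hΦ, if_neg h6, if_neg h2']
    norm_num
  rw [hL, hR] at heven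
  split_ifs at heven <;> norm_num at heven

/-! ### §2 Assembly into the `5`-standard multiset -/

/-- **The full fibre of `ℤ/5q → ℤ/q` over a unit residue `b₁`**, written as Aoki's progression
`{a + i q : i < 5}` for a unit `a` of the fibre, is the unit fibre plus the one point `≡ 0 (mod 5)`.
[cite: Aoki1987, §1 p. 387] -/
theorem fibre_add_point_eq_range_map (hq : 7 ≤ q) {b₁ : (ZMod q)ˣ} (a : (ZMod (5 * q))ˣ)
    (ha : ZMod.unitsMap (dvd_mul_left q 5) a = b₁) {y : ZMod (5 * q)}
    (hy5 : ZMod.castHom (dvd_mul_right 5 q) (ZMod 5) y = 0) (hyq : ZMod.castHom (dvd_mul_left q 5) (ZMod q) y = b₁) :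
    (univ.filter fun x : (ZMod (5 * q))ˣ ↦ ZMod.unitsMap (dvd_mul_left q 5) x = b₁).val.map
        (fun x : (ZMod (5 * q))ˣ ↦ (x : ZMod (5 * q))) + {y} =
      (Multiset.range 5).map fun i : ℕ ↦ (a : ZMod (5 * q)) + (i : ZMod (5 * q)) * ((5 * q / 5 : ℕ) : ZMod (5 * q)) := by
  classical
  have hpq : (5 : ℕ) ≠ q := five_ne hq
  have hqq : 5 * q / 5 = q := by omega
  rw [range_map_eq_filter_of_dvd_one (dvd_mul_right 5 q) (a : ZMod (5 * q))]
  -- membership in the full fibre is `x ≡ a (mod q)`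
  have hmem : ∀ x : ZMod (5 * q), x.val % (5 * q / 5) = (a : ZMod (5 * q)).val % (5 * q / 5) ↔
      ZMod.castHom (dvd_mul_left q 5) (ZMod q) x = b₁ := by
    intro x
    rw [hqq, ← ZMod.natCast_eq_natCast_iff', ZMod.castHom_apply, ZMod.cast_eq_val]
    have : ((a : ZMod (5 * q)).val : ZMod q) = (b₁ : ZMod q) := by
      rw [← ZMod.cast_eq_val, ← ZMod.castHom_apply (h := dvd_mul_left q 5), ← coe_unitsMap, ha]
    rw [this]
  have hy0 : y ≠ 0 := fun h ↦ by rw [h, map_zero] at hyq; exact (Units.ne_zero b₁) hyq.symm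
  have hyu : ¬ IsUnit y := fun h ↦ cast_ne_zero_of_isUnit' h hy5
  ext x
  rw [Multiset.count_add, count_fibreMultiset, Multiset.count_singleton]
  have hnd : (univ.filter fun x : ZMod (5 * q) ↦ x.val % (5 * q / 5) = (a : ZMod (5 * q)).val % (5 * q / 5)).val.Nodup :=
    Finset.nodup _
  by_cases hxb : ZMod.castHom (dvd_mul_left q 5) (ZMod q) x = b₁
  · -- `x` in the full fibre: count `1` on the right
    rw [Multiset.count_eq_one_of_mem hnd (by simpa [Finset.mem_filter] using (hmem x).mpr hxb)]
    have hx0 : x ≠ 0 := fun h ↦ by rw [h, map_zero] at hxb; exact (Units.ne_zero b₁) hxb.symm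
    rcases trichotomy hpq hx0 with hxu | ⟨hx5, -⟩ | ⟨-, hxq⟩
    · rw [if_pos ⟨hxu.unit, hxu.unit_spec, by apply Units.ext; rw [coe_unitsMap, hxu.unit_spec, hxb]⟩, if_neg]
      exact fun h ↦ hyu (h ▸ hxu)
    · -- level `q`: `x = y`
      rw [if_neg, if_pos (eq_of_casts_eq hpq (hx5.trans hy5.symm) (hxb.trans hyq.symm))]
      rintro ⟨w, hw, -⟩
      exact cast_ne_zero_of_isUnit' (hw ▸ Units.isUnit w) hx5
    · exact absurd hxq (by rw [hxb]; exact Units.ne_zero b₁)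
  · -- `x` off the full fibre: count `0` on both sides
    rw [Multiset.count_eq_zero_of_notMem (by simpa [Finset.mem_filter] using fun h ↦ hxb ((hmem x).mp h))]
    rw [if_neg, if_neg]
    · exact fun h ↦ hxb (by rw [h, hyq])
    · rintro ⟨w, hw, hwb⟩
      exact hxb (by rw [← hw, ← coe_unitsMap, hwb])

/-- **CLASSIFICATION OF THE HODGE SEXTUPLES OF LEVEL `5q`** (`q ≥ 7` prime): three pairs, or Aoki's
`5`-standard multiset `σ_{5,a}` of a unit `a` (in the spelling of the line's printed supply).
[cite: Aoki1983, Thm. A′ (§7)] [cite: Aoki1987, §1 p. 387] -/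
theorem classification : ∀ {q : ℕ} [Fact q.Prime], 7 ≤ q → ∀ {s : Multiset (ZMod (5 * q))}, IsHodgeMultiset s →
    Multiset.card s = 6 →
    (∃ Q : Multiset (ZMod (5 * q)), (∀ a ∈ Q, a ≠ 0) ∧ s = Q + Q.map (fun a ↦ -a)) ∨
    ∃ a : ZMod (5 * q), IsUnit a ∧
      s = (Multiset.range 5).map (fun i : ℕ ↦ a + (i : ZMod (5 * q)) * ((5 * q / 5 : ℕ) : ZMod (5 * q))) +
        {-((5 : ZMod (5 * q)) * a)} := by
  intro q _ hq s hs h6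
  classical
  have hpq : (5 : ℕ) ≠ q := five_ne hq
  rcases structure_units hq hs h6 with hsym | ⟨b₁, hocc, hoff⟩
  · exact Or.inl (exists_pairs_of_symmetric hq hs hsym)
  right
  obtain ⟨y₀, z₀, hsyz₀⟩ := exists_eq_fibre_add_pair hq h6 hocc
  obtain ⟨hy5₀, hz5₀, hyq₀, hzq₀, hsum₀⟩ := pair_level_q hq hs hsyz₀ hoff
  -- orient the pair so that `ȳ = b₁`
  obtain ⟨y, z, hsyz, hy5, hz5, hyq, hzq, hsum, hyb⟩ : ∃ y z : ZMod (5 * q),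
      s = (univ.filter fun x : (ZMod (5 * q))ˣ ↦ ZMod.unitsMap (dvd_mul_left q 5) x = b₁).val.map
        (fun x : (ZMod (5 * q))ˣ ↦ (x : ZMod (5 * q))) + {y, z} ∧
      ZMod.castHom (dvd_mul_right 5 q) (ZMod 5) y = 0 ∧ ZMod.castHom (dvd_mul_right 5 q) (ZMod 5) z = 0 ∧
      ZMod.castHom (dvd_mul_left q 5) (ZMod q) y ≠ 0 ∧ ZMod.castHom (dvd_mul_left q 5) (ZMod q) z ≠ 0 ∧
      ZMod.castHom (dvd_mul_left q 5) (ZMod q) y + ZMod.castHom (dvd_mul_left q 5) (ZMod q) z = -(4 * (b₁ : ZMod q)) ∧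
      ZMod.castHom (dvd_mul_left q 5) (ZMod q) y = b₁ := by
    have hyu : ¬ IsUnit y₀ := fun h ↦ cast_ne_zero_of_isUnit' h hy5₀
    have hzu : ¬ IsUnit z₀ := fun h ↦ cast_ne_zero_of_isUnit' h hz5₀
    rcases casts_pair_eq hq hs hsyz₀ hyu hzu with h | h
    · exact ⟨y₀, z₀, hsyz₀, hy5₀, hz5₀, hyq₀, hzq₀, hsum₀, h⟩
    · refine ⟨z₀, y₀, by rw [hsyz₀, Multiset.pair_comm], hz5₀, hy5₀, hzq₀, hyq₀, by rw [add_comm]; exact hsum₀, h⟩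
  have hzb : ZMod.castHom (dvd_mul_left q 5) (ZMod q) z = -(5 * (b₁ : ZMod q)) := by
    rw [hyb] at hsum; linear_combination hsum
  -- a unit `a` of the fibre
  obtain ⟨a, -, ha⟩ := exists_unit_of_unitsMap hpq (1 : (ZMod 5)ˣ) b₁
  refine ⟨a, Units.isUnit a, ?_⟩
  rw [← fibre_add_point_eq_range_map hq a ha hy5 hyb, hsyz, add_assoc]
  congr 1
  -- `{y, z} = {y} + {-(5a)}`: `z = -5a` by its two reductions
  have hz : z = -((5 : ZMod (5 * q)) * a) := by
    refine eq_of_casts_eq hpq ?_ ?_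
    · rw [hz5, map_neg, map_mul, map_ofNat, show (5 : ZMod 5) = 0 by decide, zero_mul, neg_zero]
    · rw [hzb, map_neg, map_mul, map_ofNat, ← coe_unitsMap, ha]
  rw [hz, Multiset.insert_eq_cons, Multiset.singleton_add]

end Level5q

end Summit.HodgeConjecture.HodgeConjecture.Theorems.CancelByAnyClaimLattice.FiveQ
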